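import Mathlib
import HarnessLib
import Summits.NavierStokesRegularity.NavierStokesRegularity.Theorems.HalfSpaceWindowDoorCirculationCarryingRigidityDefs
import Summits.NavierStokesRegularity.NavierStokesRegularity.Theorems.HalfSpaceWindowDoorCirculationCarryingRigidityAsymptoticPlanarity
import Summits.NavierStokesRegularity.NavierStokesRegularity.Theorems.HalfSpaceWindowDoorCirculationCarryingRigidityPeriodicStratum
import Summits.NavierStokesRegularity.NavierStokesRegularity.Theorems.PoloidalWindowDoorPoloidalWindowRigidityWindow
import Summits.NavierStokesRegularity.NavierStokesRegularity.Theorems.PoloidalWindowDoorPoloidalWindowRigidityFlat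
import Literature.Analysis.FluidPDE.VorticityCalculus

/-!
# Route `HalfSpaceWindowDoor`, crux `CirculationCarryingRigidity` (stmt-NavierStokesRegularity-25311) — census (SIGN-FREE
# row): ONE PERIODIC SLICE kills a door-class profile

LEAD ns-hsw-p1 g11 (cell pub-ns-dss).  The periodic stratum of the door class is empty (g7, `…PeriodicStratum.eq_zero_of_periodic`:
`InDoorClass C v` + `v(t, x + e) = v(t, x)` for ALL `t < 0`, `e ≠ 0` ⇒ `v ≡ 0`).  As for the translation-invariant stratum
(`…AsymptoticPlanarity.lineInvariant_of_slice`), periodicity of ONE slice propagates to the whole slab — forward by uniqueness of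
bounded Oseen-mild solutions (`IsTypeIAncientMild.comp_add_eq_after`), backward by real-analyticity in time — so:

* `shiftInvariant_of_slice` — one `e`-periodic slice ⇒ every slice is `e`-periodic (any `e`, Type-I ancient mild class);
* `eq_zero_of_periodic_slice` — door class + ONE `e`-periodic slice, `e ≠ 0` ⇒ `v ≡ 0`; `not_isBackwardSingularPoint_of_periodic_slice`,
  `inner_curl_e3_eq_zero_of_periodic_slice`, `hemisphereLiouvilleE3_of_periodic_slice` (the W6 census row; the sign is idle).

CENSUS READING: an enemy of W6 (indeed any non-zero door-class profile, also of the sister crux 19708) has NO periodic time slice,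
in NO direction, at NO instant.

WHAT THIS IS NOT: not a statement about Navier–Stokes regularity (Clay A); the door statements concern HYPOTHETICAL blow-up
profiles (KNSS ancient mild solutions); helper `--supports` 25311; the item stays OPEN at its research stub.
-/

noncomputable section

-- the summit and its single sub-problem share the name (CONVENTIONS §1), as in every Theorems file
set_option linter.dupNamespace false

namespace Summit.NavierStokesRegularity.NavierStokesRegularity.Theorems.HalfSpaceWindowDoorCirculationCarryingRigidityPeriodicSlice

open MeasureTheory Set Function Filter Topology
open scoped RealInnerProductSpace InnerProductSpace
open Literature.Analysis Literature.Analysis.FluidPDE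
open Summit.NavierStokesRegularity.NavierStokesRegularity.Theorems.HalfSpaceWindowDoorCirculationCarryingRigidityDefs
  (InDoorClass SignE3 e3 HemisphereLiouvilleE3)
open Summit.NavierStokesRegularity.NavierStokesRegularity.Theorems.PoloidalWindowDoorPoloidalWindowRigidityWindow
  (isTypeIAncientMild_of_class)
open Summit.NavierStokesRegularity.NavierStokesRegularity.Theorems.LocalSineTubeDoorProfileAlignedWindowRigidityAncient
  (analyticOnNhd_uncurry bdd_of_hasTypeITimeDecay)
open Summit.NavierStokesRegularity.NavierStokesRegularity.Theorems.HalfSpaceWindowDoorCirculationCarryingRigidityPeriodicStratum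
  (eq_zero_of_periodic)
open Summit.NavierStokesRegularity.NavierStokesRegularity.Theorems.PoloidalWindowDoorPoloidalWindowRigidityFlat
  (not_backwardSingular_of_zero)

variable {C : ℝ} {v : ℝ → EuclideanSpace ℝ (Fin 3) → EuclideanSpace ℝ (Fin 3)}

/-- **One `e`-periodic slice ⇒ every slice is `e`-periodic** for Type-I ancient mild fields: forward by uniqueness of bounded
Oseen-mild solutions (`IsTypeIAncientMild.comp_add_eq_after`), backward by real-analyticity in time (identity theorem on
`(−∞, 0)`). -/
theorem shiftInvariant_of_slice {W : ℝ → EuclideanSpace ℝ (Fin 3) → EuclideanSpace ℝ (Fin 3)} (hW : IsTypeIAncientMild C W)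
    {s₀ : ℝ} (hs₀ : s₀ < 0) {e : EuclideanSpace ℝ (Fin 3)} (hA : ∀ x : EuclideanSpace ℝ (Fin 3), W s₀ (x + e) = W s₀ x) :
    ∀ t < 0, ∀ x : EuclideanSpace ℝ (Fin 3), W t (x + e) = W t x := by
  have hB : ∀ t, s₀ < t → t < 0 → ∀ x : EuclideanSpace ℝ (Fin 3), W t (x + e) = W t x :=
    hW.comp_add_eq_after hs₀ (b := e) hA
  have han : AnalyticOnNhd ℝ (uncurry W) (Iio (0 : ℝ) ×ˢ univ) :=
    analyticOnNhd_uncurry hW.continuousOn_uncurry (bdd_of_hasTypeITimeDecay hW.hasTypeITimeDecay)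
      fun s t hst ht y => hW.mild_eq_heatExtension hst ht y
  intro t ht x
  have hline : ∀ z : EuclideanSpace ℝ (Fin 3), AnalyticOnNhd ℝ (fun τ : ℝ => W τ z) (Iio (0 : ℝ)) := fun z =>
    han.comp₂ analyticOnNhd_id analyticOnNhd_const fun _ hτ => mk_mem_prod hτ (mem_univ _)
  have hdiff : AnalyticOnNhd ℝ (fun τ : ℝ => W τ (x + e) - W τ x) (Iio (0 : ℝ)) := (hline (x + e)).sub (hline x)
  have hev : (fun τ : ℝ => W τ (x + e) - W τ x) =ᶠ[𝓝 (s₀ / 2)] 0 := by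
    filter_upwards [Ioo_mem_nhds (show s₀ < s₀ / 2 by linarith) (show s₀ / 2 < 0 by linarith)] with τ hτ
    simp only [Pi.zero_apply, sub_eq_zero]
    exact hB τ hτ.1 hτ.2 x
  have h0 : s₀ / 2 ∈ Iio (0 : ℝ) := show s₀ / 2 < 0 by linarith
  have h := hdiff.eqOn_zero_of_preconnected_of_eventuallyEq_zero isPreconnected_Iio h0 hev ht
  simpa [sub_eq_zero] using h

/-- **ONE periodic slice kills a door-class profile**: if a door-class profile has one slice `v(s₀)`, `s₀ < 0`, which is periodic
with a period `e ≠ 0`, then `v ≡ 0` on the slab (no sign hypothesis). -/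
theorem eq_zero_of_periodic_slice (hv : InDoorClass C v) {s₀ : ℝ} (hs₀ : s₀ < 0) {e : EuclideanSpace ℝ (Fin 3)} (he : e ≠ 0)
    (hper : ∀ x, v s₀ (x + e) = v s₀ x) : ∀ t < 0, ∀ x, v t x = 0 := by
  obtain ⟨hrate, hcont, hmild, hdiv⟩ := hv
  have hA : IsTypeIAncientMild C v := isTypeIAncientMild_of_class hrate hcont hmild hdiv
  exact eq_zero_of_periodic hrate hcont hmild hdiv he (shiftInvariant_of_slice hA hs₀ hper)

/-- … hence it is NOT backward singular at the apex. -/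
theorem not_isBackwardSingularPoint_of_periodic_slice (hv : InDoorClass C v) {s₀ : ℝ} (hs₀ : s₀ < 0)
    {e : EuclideanSpace ℝ (Fin 3)} (he : e ≠ 0) (hper : ∀ x, v s₀ (x + e) = v s₀ x) :
    ¬ IsBackwardSingularPoint v 0 :=
  not_backwardSingular_of_zero (eq_zero_of_periodic_slice hv hs₀ he hper)

/-- … and POLOIDAL along `e₃` (indeed zero; the row of the W6 census). -/
theorem inner_curl_e3_eq_zero_of_periodic_slice (hv : InDoorClass C v) {s₀ : ℝ} (hs₀ : s₀ < 0)
    {e : EuclideanSpace ℝ (Fin 3)} (he : e ≠ 0) (hper : ∀ x, v s₀ (x + e) = v s₀ x) :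
    ∀ s < 0, ∀ y, ⟪curl (v s) y, e3⟫ = 0 := by
  intro s hs y
  have hz : v s = 0 := funext fun x => eq_zero_of_periodic_slice hv hs₀ he hper s hs x
  rw [hz, curl_zero]
  simp

/-- **W6 = `HemisphereLiouvilleE3` RESTRICTED TO PROFILES WITH ONE PERIODIC SLICE** (hypotheses of `HemisphereLiouvilleE3` verbatim —
the sign is idle here — plus one `e`-periodic slice, `e ≠ 0`). -/
theorem hemisphereLiouvilleE3_of_periodic_slice (C : ℝ) (v : ℝ → EuclideanSpace ℝ (Fin 3) → EuclideanSpace ℝ (Fin 3))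
    (hrate : HasTypeITimeDecay C v) (hcont : ContinuousOn (Function.uncurry v) (Set.Iio (0 : ℝ) ×ˢ Set.univ))
    (hmild : ∀ s t : ℝ, s < t → t < 0 → ∀ x,
      v t x = UnboundedOperators.heatExtension (v s) (t - s) x - oseenDuhamel 1 s v v t x)
    (hdiv : ∀ t < 0, VectorCalculus.IsDivFree (v t)) (_hsign : ∀ s < 0, ∀ y, 0 ≤ ⟪curl (v s) y, e3⟫)
    {s₀ : ℝ} (hs₀ : s₀ < 0) {e : EuclideanSpace ℝ (Fin 3)} (he : e ≠ 0) (hper : ∀ x, v s₀ (x + e) = v s₀ x) :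
    ∀ s < 0, ∀ y, ⟪curl (v s) y, e3⟫ = 0 :=
  inner_curl_e3_eq_zero_of_periodic_slice ⟨hrate, hcont, hmild, hdiv⟩ hs₀ he hper

end Summit.NavierStokesRegularity.NavierStokesRegularity.Theorems.HalfSpaceWindowDoorCirculationCarryingRigidityPeriodicSlice

end
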